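import Summits.AtomisticToContinuum.FouriersLaw.Theses.GriffithsLimitExchange
import Summits.AtomisticToContinuum.FouriersLaw.Theorems.GriffithsLimitExchangeKernelIntegrable

/-!
# Birth skeleton (BC3) for crux `GriffithsLimitExchange.PositiveTransmission`

Item `stmt-AtomisticToContinuum-13201` — rank-5 crux of route `route-AtomisticToContinuum-GriffithsLimitExchange`
(sub-problem `FouriersLaw`). Registrar: `planner-skel-stmt-AtomisticToContinuum-13201-0` (skeleton-register, 2026-08-17).
Crux decl (FIXED, concluded BY NAME below):
`Summit.AtomisticToContinuum.FouriersLaw.Theses.GriffithsLimitExchange.PositiveTransmission` —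
NOT AN INSULATOR AT THE DIFFUSIVE SCALE: for all parameters `> 0`, `T > 0` there are `A₀, c > 0` with
`N · X_N(A₀ N²) ≥ c` eventually in `N`, where `X_N(t) = (γ/T²) ∫_{(0,t]} Kt_N`, `Kt_N(u) = Cov_T(p_0²(0), p²_{N-1}(u))`
(constructed kernels `P.transitionKernel N T T u⁺`, Gibbs state `P.gibbsMeasure N T`, `P = pinnedChain ω₂ lam β γ`).

## The line (`exit-ledger transfer`): finite-horizon transmission floor ⇐ steady-state return ceiling

Notation: `K_N(u) = Cov_T(p_0²(0), p_0²(u))` (return kernel), `Kt_N` (transmission kernel) as in the route file.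

* `stub_exitIdentity` (size M–L, provable with the fixed-`N` engine in tree) — EXIT IDENTITY
  `γ · (∫_{(0,∞)} K_N + ∫_{(0,∞)} Kt_N) = T²` for every `N ≥ 1`: Dynkin for `H` under the constructed semigroup
  (`L H = -γ[(p_0² - T) + (p²_{N-1} - T)]` at equal bath temperatures; for `N = 1` both baths sit on site `0` and
  `Kt_1 = K_1`), `Cov_T(p_0², H) = Var_T(p_0²)/2 = T²` (Gaussian momentum marginal), and decay of
  `Cov_T(p_0²(0), H(t))` from the proved exponential ergodicity (CEHR 2018 Thm 2.13 (3)) + kernel integrability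
  (landed `GriffithsLimitExchange.kernelIntegrable_proof`). It is the route's foreseen layer-2 node `ExitIdentity`
  (TWO-LAYER PLAN of the route header) and says `S_N(0) = 1`: every unit of boundary-injected energy eventually
  leaves through one of the two baths.
* `stub_returnDeficitFloor` (OPEN — the load-bearing stub; the positivity-of-`κ` content in its `t = ∞`, RETURN form) —
  `∃ c > 0`, eventually in `N`: `(γ/T²) ∫_{(0,∞)} K_N ≤ 1 - c/N`: at most the fraction `1 - c/N` of the energy injected
  at the left bath returns to it; equivalently (exit identity) the end-to-end transmission obeys `N · E_N ≥ c`
  (an Ohmic LOWER bound on the conductance `(N-1)γE_N = D_N`, cf. `AbelianSqueeze.ConductanceLowerBound` via the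
  route's `ResponseIdentity`, and the lower half of `BoundaryEscapeDeficit.DiffusiveCrossover ∘ HalfChainTailLaw`,
  whose escape deficit is literally `1 - (γ/T²)∫K_N`). TRANSFER, why easier than the crux as cut: `∫_{(0,∞)} K_N du =
  ⟨f, (-L_N)⁻¹ f⟩_{L²(μ_T)}` with `f = p_0² - T` is a RESOLVENT QUADRATIC FORM of the equilibrium generator, which has
  exact two-sided variational (primal–dual, Dirichlet–Thomson type) characterisations for the non-reversible
  `L_N = 𝒜_N + γS_∂` (Bernardin–Olla 2011 §6; Komorowski–Landim–Olla 2012 Ch. 2; in tree for this chain: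
  `StaticAbelianSqueeze` weak duality): an UPPER bound `≤ (T²/γ)(1 - c/N)` follows from ONE good trial pair
  (a linear temperature-profile corrector), with no control of the dynamics at times `≫ N²` and no sign input.
* `stub_transmissionTailCapture` (open, plausibly M–L given any diffusive decay; strictly weaker than the route's
  `BoundaryDEP ∧ VanishingSurvival`, which give `0 ≤ ∫_{(t,∞)} Kt_N ≤ (T²/γ) S_N(t)`) — DIFFUSIVE CAPTURE OF THE
  TRANSMISSION TAIL: `∀ ε > 0 ∃ A > 0`, eventually in `N`: `N · (γ/T²) ∫_{(AN²,∞)} Kt_N ≤ ε` (only an UPPER bound on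
  the late transmission is needed: what has not yet crossed by the diffusive time `AN²` is `≤ ε/N`).

COMPOSITION (kernel-checked, no `sorry` of its own): `positiveTransmission_abstract` = the implication
"stub signatures (kernels abstracted to `K Kt : ℕ → ℝ → ℝ`) + integrability ⇒ crux conclusion" (real analysis:
split `(0,∞) = (0,AN²] ∪ (AN²,∞)` using the LANDED integrability of `Kt_N`, normalise the exit identity by
`T² > 0`, floor `N·E_N ≥ c`, subtract the captured tail `≤ c/2`; witnesses `A = A(c/2)`, `c/2`), and the skeleton
theorem `PositiveTransmission_of : GriffithsLimitExchange.PositiveTransmission` (BY NAME, no hypotheses — the A12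
registered shape), which specialises it to the three declared stubs by name via `dsimp only`.
BC3 record (registrar folder `bc/stub_*_probe.lean`): for each stub, `stub-sig → PositiveTransmission` and
`stub-sig → FouriersLaw` by `first | exact? | simpa | simpa [C] | (unfold C; simpa) | aesop` FAIL (6/6, rc 1
"unsolved goals", aesop exhaustive-search failure); `lean check` of this file: rc 0, 3 sorries = the 3 stubs.

Hardest stub: `stub_returnDeficitFloor` (= the crux's open content, moved to the steady state where variational
tools act). Calibration: `N = 1`: `(γ/T²)∫K_1 = 1/2`; Fourier phenomenology `E_N ≈ κ/(γN)`, tail beyond `AN²`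
`≈ (κ/γ) e^{-π²DA}/N`. Harmonic corner (`lam = β = 0`, excluded): exit identity and floor hold (`E_N → E_∞ > 0`),
tail capture is the statement that fails there only marginally (gap `≍ N⁻³`) — the line does not lean on the
harmonic member. Disproof.lean: none exists for this crux at registration (`ledger crux ls`: no workfiles);
`ledger negatives`: nothing on these kernels (refuter rreview-0815T19-2). No stub is an instance of a landed
Negative lemma (none under `Theorems/PositiveTransmission/`).
-/

noncomputable section

open MeasureTheory Filter Topology Set

namespace Summit.AtomisticToContinuum.FouriersLaw.Cruxes.PositiveTransmission.Birth

/-! ## Registered stubs (`sorry` lives only here) -/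

/-- **Stub 1 · exitIdentity** (M–L). For `P = pinnedChain ω₂ lam β γ` (all `> 0`), `T > 0` and every `N ≥ 1`:
`γ · (∫_{(0,∞)} K_N + ∫_{(0,∞)} Kt_N) = T²` — complete exit of boundary-injected energy through the two baths
(Dynkin for `H`: `L H = -γ[(p_0² - T) + (p²_{N-1} - T)]`; `Cov_T(p_0², H) = T²`; mixing at fixed `N`).
Leans on: `OscillatorChain.transitionKernel/gibbsMeasure` (constructed), CEHR 2018 Thm 2.13 in tree,
`GriffithsLimitExchange.kernelIntegrable_proof`. [cite: KunduDharNarayan2009; BonettoLebowitzReyBellet2000 §5] -/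
theorem stub_exitIdentity :
    ∀ ω₂ lam β γ : ℝ, 0 < ω₂ → 0 < lam → 0 < β → 0 < γ → ∀ T : ℝ, 0 < T → (let P := Literature.MathematicalPhysics.KineticTheory.HeatConduction.pinnedChain ω₂ lam β γ; let K : ℕ → ℝ → ℝ := fun N u => if h : 0 < N then ∫ z, ((z.2 ⟨0, h⟩) ^ 2 - T) * (∫ y, ((y.2 ⟨0, h⟩) ^ 2 - T) ∂(P.transitionKernel N T T u.toNNReal z)) ∂(P.gibbsMeasure N T) else 0; let Kt : ℕ → ℝ → ℝ := fun N u => if h : 0 < N then ∫ z, ((z.2 ⟨0, h⟩) ^ 2 - T) * (∫ y, ((y.2 ⟨N - 1, by omega⟩) ^ 2 - T) ∂(P.transitionKernel N T T u.toNNReal z)) ∂(P.gibbsMeasure N T) else 0; ∀ N : ℕ, 0 < N → γ * ((∫ u in Set.Ioi (0 : ℝ), K N u) + ∫ u in Set.Ioi (0 : ℝ), Kt N u) = T ^ 2) := by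
  sorry

/-- **Stub 2 · returnDeficitFloor** (OPEN; load-bearing; the transfer). For all parameters `> 0` and `T > 0`
there is `c > 0` with, eventually in `N`, `(γ/T²) ∫_{(0,∞)} K_N ≤ 1 - c/N`: the boundary RETURN resolvent form
`⟨p_0² - T, (-L_N)⁻¹ (p_0² - T)⟩_{μ_T}` stays an Ohmic amount `c·T²/(γN)` below its trivial ceiling `T²/γ`
(= not an insulator, steady-state form; primal–dual variational bounds for `L_N = 𝒜_N + γ S_∂` apply).
Why it might fail: no N-uniform Ohmic lower bound is proved for any deterministic anharmonic bulk; asymptotic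
localisation makes `c(T)` super-polynomially small (DeRoeckHuveneers2015) — allowed at fixed `T`.
[cite: BernardinOlla2011 §6; BonettoLebowitzReyBellet2000 §6.3; Dhar2008 §9] -/
theorem stub_returnDeficitFloor :
    ∀ ω₂ lam β γ : ℝ, 0 < ω₂ → 0 < lam → 0 < β → 0 < γ → ∀ T : ℝ, 0 < T → (let P := Literature.MathematicalPhysics.KineticTheory.HeatConduction.pinnedChain ω₂ lam β γ; let K : ℕ → ℝ → ℝ := fun N u => if h : 0 < N then ∫ z, ((z.2 ⟨0, h⟩) ^ 2 - T) * (∫ y, ((y.2 ⟨0, h⟩) ^ 2 - T) ∂(P.transitionKernel N T T u.toNNReal z)) ∂(P.gibbsMeasure N T) else 0; ∃ c : ℝ, 0 < c ∧ ∀ᶠ N : ℕ in Filter.atTop, γ / T ^ 2 * (∫ u in Set.Ioi (0 : ℝ), K N u) ≤ 1 - c / (N : ℝ)) := by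
  sorry

/-- **Stub 3 · transmissionTailCapture** (diffusive capture of the late transmission; weaker than
`BoundaryDEP ∧ VanishingSurvival` of the route). For all parameters `> 0`, `T > 0` and every `ε > 0` there is a
horizon `A > 0` with, eventually in `N`, `N · (γ/T²) ∫_{(AN², ∞)} Kt_N ≤ ε`.
Why it might fail: sub-diffusive trapping / long-lived boundary breathers (strong anharmonicity) could leave an
`O(1/N)` transmission arriving later than every diffusive horizon. [cite: BonettoLebowitzReyBellet2000 §6;
LepriLiviPoliti2003; DeRoeckHuveneers2015] -/
theorem stub_transmissionTailCapture :
    ∀ ω₂ lam β γ : ℝ, 0 < ω₂ → 0 < lam → 0 < β → 0 < γ → ∀ T : ℝ, 0 < T → (let P := Literature.MathematicalPhysics.KineticTheory.HeatConduction.pinnedChain ω₂ lam β γ; let Kt : ℕ → ℝ → ℝ := fun N u => if h : 0 < N then ∫ z, ((z.2 ⟨0, h⟩) ^ 2 - T) * (∫ y, ((y.2 ⟨N - 1, by omega⟩) ^ 2 - T) ∂(P.transitionKernel N T T u.toNNReal z)) ∂(P.gibbsMeasure N T) else 0; ∀ ε : ℝ, 0 < ε → ∃ A : ℝ, 0 <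 A ∧ ∀ᶠ N : ℕ in Filter.atTop, (N : ℝ) * (γ / T ^ 2 * ∫ u in Set.Ioi (A * (N : ℝ) ^ 2), Kt N u) ≤ ε) := by
  sorry

/-! ## Composition (sorry-free) -/

/-- **Abstract composition** (pure real analysis, kernels abstracted to `K Kt : ℕ → ℝ → ℝ`): integrability of
`Kt N` on `(0,∞)`, the exit identity, the return-deficit floor and the tail capture give the finite-horizon
transmission floor `N · (γ/T²) ∫_{(0, AN²]} Kt_N ≥ c/2` eventually. -/
theorem positiveTransmission_abstract {γ T : ℝ} (hT : 0 < T) {K Kt : ℕ → ℝ → ℝ}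
    (hKI : ∀ N : ℕ, IntegrableOn (K N) (Ioi 0) ∧ IntegrableOn (Kt N) (Ioi 0))
    (hExit : ∀ N : ℕ, 0 < N → γ * ((∫ u in Ioi (0 : ℝ), K N u) + ∫ u in Ioi (0 : ℝ), Kt N u) = T ^ 2)
    (hFloor : ∃ c : ℝ, 0 < c ∧ ∀ᶠ N : ℕ in atTop, γ / T ^ 2 * (∫ u in Ioi (0 : ℝ), K N u) ≤ 1 - c / (N : ℝ))
    (hTail : ∀ ε : ℝ, 0 < ε → ∃ A : ℝ, 0 < A ∧ ∀ᶠ N : ℕ in atTop,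
      (N : ℝ) * (γ / T ^ 2 * ∫ u in Ioi (A * (N : ℝ) ^ 2), Kt N u) ≤ ε) :
    ∃ A c : ℝ, 0 < A ∧ 0 < c ∧ ∀ᶠ N : ℕ in atTop,
      c ≤ (N : ℝ) * (γ / T ^ 2 * ∫ u in Ioc (0 : ℝ) (A * (N : ℝ) ^ 2), Kt N u) := by
  obtain ⟨c, hc, hfl⟩ := hFloor
  obtain ⟨A, hA, htl⟩ := hTail (c / 2) (by positivity)
  refine ⟨A, c / 2, hA, by positivity, ?_⟩
  filter_upwards [hfl, htl, eventually_gt_atTop 0] with N hflN htlN hNpos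
  have hN : (0 : ℝ) < N := Nat.cast_pos.2 hNpos
  have hNne : (N : ℝ) ≠ 0 := hN.ne'
  have hTne : T ≠ 0 := hT.ne'
  have hT2 : (0 : ℝ) < T ^ 2 := by positivity
  have ht : (0 : ℝ) ≤ A * (N : ℝ) ^ 2 := by positivity
  -- split the total transmission at the diffusive horizon `t = A·N²`
  have hsplit : (∫ u in Ioi (0 : ℝ), Kt N u) =
      (∫ u in Ioc (0 : ℝ) (A * (N : ℝ) ^ 2), Kt N u) + ∫ u in Ioi (A * (N : ℝ) ^ 2), Kt N u := by
    rw [← Ioc_union_Ioi_eq_Ioi ht]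
    exact setIntegral_union (Ioc_disjoint_Ioi le_rfl) measurableSet_Ioi
      ((hKI N).2.mono_set Ioc_subset_Ioi_self) ((hKI N).2.mono_set (Ioi_subset_Ioi ht))
  -- the exit identity, normalised: `(γ/T²)∫Kt = 1 - (γ/T²)∫K`
  have hex := hExit N hNpos
  have hKt : γ / T ^ 2 * (∫ u in Ioi (0 : ℝ), Kt N u) =
      1 - γ / T ^ 2 * ∫ u in Ioi (0 : ℝ), K N u := by
    field_simp
    linarith [hex]
  -- the floor in transmission form: `c ≤ N · (γ/T²)∫Kt`
  have hmul := mul_le_mul_of_nonneg_left hflN hN.le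
  have hNc : (N : ℝ) * (1 - c / (N : ℝ)) = (N : ℝ) - c := by
    field_simp
  have hfloorE : c ≤ (N : ℝ) * (γ / T ^ 2 * ∫ u in Ioi (0 : ℝ), Kt N u) := by
    rw [hKt]
    rw [hNc] at hmul
    nlinarith [hmul]
  -- subtract the captured tail
  rw [hsplit] at hfloorE
  have hdist : (N : ℝ) * (γ / T ^ 2 * ((∫ u in Ioc (0 : ℝ) (A * (N : ℝ) ^ 2), Kt N u) +
      ∫ u in Ioi (A * (N : ℝ) ^ 2), Kt N u)) =
      (N : ℝ) * (γ / T ^ 2 * ∫ u in Ioc (0 : ℝ) (A * (N : ℝ) ^ 2), Kt N u) +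
        (N : ℝ) * (γ / T ^ 2 * ∫ u in Ioi (A * (N : ℝ) ^ 2), Kt N u) := by
    ring
  rw [hdist] at hfloorE
  linarith

/-- **Skeleton theorem: the three declared stubs (by name) + the LANDED `KernelIntegrable`
(`GriffithsLimitExchange.kernelIntegrable_proof`) prove the crux BY NAME.** Registered shape (A12
`#h21_check_skeleton`): no hypotheses; `sorry` enters only through `stub_exitIdentity`, `stub_returnDeficitFloor`,
`stub_transmissionTailCapture`; the implication "stub signatures ⇒ crux conclusion" is the sorry-free
`positiveTransmission_abstract` above, specialised here by `dsimp only` (zeta-reduction of the route file's `let`s). -/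
theorem PositiveTransmission_of :
    Summit.AtomisticToContinuum.FouriersLaw.Theses.GriffithsLimitExchange.PositiveTransmission := by
  intro ω₂ lam β γ hω hl hβ hγ T hT
  have hKI' :=
    Summit.AtomisticToContinuum.FouriersLaw.Theorems.GriffithsLimitExchange.kernelIntegrable_proof
      ω₂ lam β γ hω hl hβ hγ T hT
  have hExit' := stub_exitIdentity ω₂ lam β γ hω hl hβ hγ T hT
  have hFloor' := stub_returnDeficitFloor ω₂ lam β γ hω hl hβ hγ T hT
  have hTail' := stub_transmissionTailCapture ω₂ lam β γ hω hl hβ hγ T hT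
  dsimp only at hKI' hExit' hFloor' hTail' ⊢
  exact positiveTransmission_abstract (γ := γ) hT hKI' hExit' hFloor' hTail'

end Summit.AtomisticToContinuum.FouriersLaw.Cruxes.PositiveTransmission.Birth

end
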